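import Summits.ResolutionOfSingularities.ResolutionOfSingularities.Theorems.PurelyInseparableDim4TschirnhausClean
import Summits.ResolutionOfSingularities.ResolutionOfSingularities.Theorems.PurelyInseparableDim4ResConeLedgerLinear
import HarnessLib
import HarnessLib.Audit.Tags

/-!
# Purely inseparable four-folds — the Tschirnhaus / W-frame move ALONG A WALK, part 1b: every admissible
# re-framing moves the residual cone by its LINEAR PART; in the band `e_G` is kept (cell `res-dim4-pi`,
# K2(p) lane, brick (ii) FILE E, supplement to part 1)

[OURS · counted 0 · cell `res-dim4-pi` · brick (ii) FILE E, seat res-dim4-p-11 g3.]  Nothing here proves K2(p),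
`NoIsolatedTrap p p` or resolution of singularities in dimension ≥ 4 / characteristic `p`.  AI kernel work,
weaker than expert review.

Part 1 (`…TschirnhausClean`) carried the residual cone of the clean re-framing `⟨clean (tsch f φ s.F), r, exc⟩`
for `ord₀ φ ≥ 2` (cone unchanged) and, in the band `p ∤ ord₀ F`, for LINEAR `φ` ((E4), FILE B3 transported).
Along a walk the data `φ k` of part 2 are neither: they have a linear part AND higher terms.  Here the general
case: the move factors as `tsch f φ = tsch f (φ − lin φ) ∘ tsch f (lin φ)` (group law of FILE B1), the
order-`≥ 2` factor is inert on initial forms (FILE B2) and the linear factor acts on them (FILE B3), so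
`in (tsch f φ F) = tsch f (lin φ) (in F)` and the residual cone of the re-framed state is `tsch f (lin φ) (g)`
(`resForm_tschState_eq_tsch_linearPart`); with part 1's band lemma `resForm_cleanTschState_eq` this gives
**`finrank_resVertex_cleanTschState`: in the band `p ∤ ord₀ F`, `e_G` is kept by EVERY admissible clean
re-framing** — a located trap keeps its slice (B: `e_G ≡ 3`, C: `e_G ≡ 2`) under the re-framings of part 2
(inside an isolated above-floor chain `p < ord₀ F ≤ 2p − 2`, `BandShade.exists_ordZero_eq`).  Off the band this
fails (part 1's located example `p = 3`, `F = x₁²x₂²x_f²`, `φ = x₁ + x₂`: `e_G` `3 → 1`).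
bears_on: LADDER-RESOLUTION:D157-DOOR2 (res-dim4-pi · K2(p) · (ii) FILE E).  Supports
stmt-ResolutionOfSingularities-16155 (helper).
-/

set_option linter.dupNamespace false -- mandated namespace of this single-conjunct summit

noncomputable section

namespace Summit.ResolutionOfSingularities.ResolutionOfSingularities.Theorems.PIDim4

namespace FrameChange

open MvPolynomial Finset
open Literature.AlgebraicGeometry.Resolution
open Literature.AlgebraicGeometry.Resolution.Hauser2010
open Literature.AlgebraicGeometry.Resolution.HauserPerlega2019
open Literature.AlgebraicGeometry.Resolution.CentreBlowup

variable {K : Type} [Field K]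

variable {f : Fin 4} {φ : MvPolynomial (Fin 4) K}

/-! ## 1. The move factors through its linear part -/

section LinearPart

variable (p : ℕ)

/-- A polynomial whose support lies in that of an `x_f`-free polynomial is `x_f`-free. [folklore] -/
theorem not_mem_vars_of_support_subset {ψ χ : MvPolynomial (Fin 4) K} (h : χ.support ⊆ ψ.support)
    (hψ : f ∉ ψ.vars) : f ∉ χ.vars :=
  (not_mem_vars_iff f χ).mpr fun d hd => (not_mem_vars_iff f ψ).mp hψ d (h hd)

/-- Homogeneous components of an `x_f`-free polynomial are `x_f`-free. [folklore] -/
theorem not_mem_vars_homogeneousComponent (hφ : f ∉ φ.vars) (n : ℕ) :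
    f ∉ (homogeneousComponent n φ).vars := by
  classical
  refine not_mem_vars_of_support_subset (fun d hd => ?_) hφ
  rw [MvPolynomial.mem_support_iff, coeff_homogeneousComponent] at hd
  split_ifs at hd with h
  · exact MvPolynomial.mem_support_iff.mpr hd
  · exact absurd rfl hd

/-- … and so is the remainder after removing one. [folklore] -/
theorem not_mem_vars_sub_homogeneousComponent (hφ : f ∉ φ.vars) (n : ℕ) :
    f ∉ (φ - homogeneousComponent n φ).vars := by
  classical
  refine not_mem_vars_of_support_subset (fun d hd => ?_) hφ
  rw [MvPolynomial.mem_support_iff, coeff_sub, coeff_homogeneousComponent] at hd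
  split_ifs at hd with h
  · rw [sub_self] at hd; exact absurd rfl hd
  · rw [sub_zero] at hd; exact MvPolynomial.mem_support_iff.mpr hd

/-- For `φ(0) = 0` the non-linear part `φ − lin φ` has order `≥ 2`. [folklore] -/
theorem two_le_ordZero_sub_homogeneousComponent_one (h0 : constantCoeff φ = 0) :
    (2 : ℕ∞) ≤ ordZero (φ - homogeneousComponent 1 φ) := by
  have h1 : ((1 : ℕ) : ℕ∞) ≤ ordZero φ := by rw [Nat.cast_one, one_le_ordZero_iff]; exact h0
  exact_mod_cast succ_le_ordZero_sub_homogeneousComponent h1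

/-- **The move factors: `tsch f φ = tsch f (φ − lin φ) ∘ tsch f (lin φ)`** (group law of FILE B1). [folklore] -/
theorem tsch_eq_comp_linearPart (hφ : f ∉ φ.vars) :
    tsch f φ = (tsch f (φ - homogeneousComponent 1 φ)).comp (tsch f (homogeneousComponent 1 φ)) := by
  rw [tsch_comp_tsch _ (not_mem_vars_homogeneousComponent hφ 1), add_sub_cancel]

/-- **`in (tsch f φ F) = tsch f (lin φ) (in F)`** for every admissible `φ`: the Tschirnhaus part (order ≥ 2) is
inert on the initial form (FILE B2) and the linear part acts on it (FILE B3). [cite: Kollar2007, Aside 3.57] [folklore] -/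
theorem initialForm_tsch_eq_tsch_linearPart (hφ : f ∉ φ.vars) (h0 : constantCoeff φ = 0)
    (F : MvPolynomial (Fin 4) K) :
    initialForm (tsch f φ F) = tsch f (homogeneousComponent 1 φ) (initialForm F) := by
  rw [tsch_eq_comp_linearPart hφ, AlgHom.comp_apply,
    initialForm_tsch_of_two_le (not_mem_vars_sub_homogeneousComponent hφ 1)
      (two_le_ordZero_sub_homogeneousComponent_one h0),
    initialForm_tsch_of_isHomogeneous_one (not_mem_vars_homogeneousComponent hφ 1)
      (homogeneousComponent_isHomogeneous 1 φ)]

/-- **The residual cone of the (unclean) re-framed state is the linear part's move of the cone**, for every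
admissible `φ`, `f` free (`r_f = 0`), `x^r ∣ F`. [folklore] -/
theorem resForm_tschState_eq_tsch_linearPart (hφ : f ∉ φ.vars) (h0 : constantCoeff φ = 0) {s : State K}
    (hr0 : s.r f = 0) (hr : ∀ d ∈ s.F.support, s.r ≤ d) :
    ResCone.resForm (⟨tsch f φ s.F, s.r, s.exc⟩ : State K) =
      tsch f (homogeneousComponent 1 φ) (ResCone.resForm s) := by
  classical
  unfold ResCone.resForm
  dsimp only
  rw [initialForm_tsch_eq_tsch_linearPart hφ h0, ← ResCone.monomial_mul_resForm hr, tsch_monomial_mul _ hr0,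
    divMonomial_monomial_mul, divMonomial_monomial_mul]

/-- The linear part of an `x_f`-free datum is a linear form `Σ cᵢ xᵢ` with `c_f = 0`. [folklore] -/
theorem exists_homogeneousComponent_one_eq_linear (hφ : f ∉ φ.vars) :
    ∃ c : Fin 4 → K, c f = 0 ∧ homogeneousComponent 1 φ = ∑ i, C (c i) * X i := by
  classical
  refine ⟨fun i => coeff (Finsupp.single i 1) φ, ?_, ?_⟩
  · exact MvPolynomial.notMem_support_iff.mp fun h =>
      one_ne_zero (((not_mem_vars_iff f φ).mp hφ _ h).symm.trans Finsupp.single_eq_same |>.symm)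
  · ext m
    rw [coeff_homogeneousComponent]
    by_cases hm : m.degree = 1
    · -- `m = e_i` for the unique letter in its support
      have hm0 : m ≠ 0 := by rintro rfl; rw [map_zero] at hm; exact zero_ne_one hm
      obtain ⟨i, hi⟩ := Finsupp.ne_iff.mp hm0
      rw [Finsupp.zero_apply] at hi
      have hmi := ResCone.eq_single_of_degree_eq_one hm hi
      rw [if_pos hm, hmi, ResCone.coeff_single_linearForm]
    · rw [if_neg hm]
      symm
      by_contra hne
      obtain h1 := isHomogeneous_linear (fun i => coeff (Finsupp.single i 1) φ) hne
      rw [ResCone.weight_one_eq_degree] at h1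
      exact hm h1

/-- **`e_G` IS KEPT BY EVERY ADMISSIBLE CLEAN RE-FRAMING IN THE BAND**: for `f` free (`r_f = 0`), `x^r ∣ F`,
`p ∤ ord₀ F`, and any `φ` with `φ(0) = 0`, `x_f ∉ vars φ`, the residual vertex of
`⟨clean (tsch f φ s.F), r, exc⟩` has the dimension of that of `s` — so a located trap keeps its slice (B: `e_G ≡ 3`,
C: `e_G ≡ 2`) under the re-framings of FILE E part 2. [folklore] -/
theorem finrank_resVertex_cleanTschState (hφ : f ∉ φ.vars) (h0 : constantCoeff φ = 0) {s : State K}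
    (hr0 : s.r f = 0) (hr : ∀ d ∈ s.F.support, s.r ≤ d) {o : ℕ} (ho : ordZero s.F = o) (hpo : ¬ p ∣ o) :
    Module.finrank K
        (ResCone.resVertex (⟨deletePthPowers p (tsch f φ s.F), s.r, s.exc⟩ : State K)) =
      Module.finrank K (ResCone.resVertex s) := by
  obtain ⟨c, hc, hlin⟩ := exists_homogeneousComponent_one_eq_linear hφ
  rw [resVertex_cleanTschState_eq p hφ h0 ho hpo]
  unfold ResCone.resVertex
  rw [resForm_tschState_eq_tsch_linearPart hφ h0 hr0 hr, hlin]
  exact finrank_additiveSubspace_tsch_linear hc _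

end LinearPart

end FrameChange

end Summit.ResolutionOfSingularities.ResolutionOfSingularities.Theorems.PIDim4

end
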